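import Summits.Ventures.PercRepro.RankLevelSetM

/-!
# PercRepro — C-025 at the tight layer for SUBFAMILIES: the Φ-matching (Hall) form, DOWN adjacency (night-1, gen 12)

The **Φ-matching form** of C-025: in the bipartite graph between the members `Z` of `U(p,q)` (`r(Z) = q`,
`E ∖ Z` spanning) and the sets `S ∈ Y(p,q)` (`q < r(S) < p`), with `Z ~ S` iff `S ⊆ E ∖ Z` (the DOWN adjacency),
a fractional matching giving every member weight `Φ(p,q)` with every `S` loaded at most `1` exists iff (Hall) every
subfamily `𝒜` of members has at least `Φ(p,q)·|𝒜|` neighbours — and any such matching proves C-025.  Census (own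
exact max-flow, night-1 g12): such a matching exists on every simple coloop-free core with at most 9 elements, UP
and DOWN.  THIS FILE: at the **tight layer** `|E| = p + q` the DOWN-Hall condition is a theorem — every member is an
independent `q`-set with a basis complement, the `u`-subsets of those bases (`q < u < p`) are independent hence in
`Y`, and the Boolean LYM shadow bound (`Finset.card_mul_le_card_mul`) gives at least `C(n,u)/C(n,p)·|𝒜|` of them at
each level.  Theorem M (`c025_of_ncard_eq`) is the case `𝒜 = U(p,q)`.

* `card_mul_choose_le_card_shadow_mul` — the shadow bound: for a family `ℬ` of `p`-subsets of a finset `E` and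
  `u ≤ p`, `#ℬ · C(p,u) ≤ #(u-subsets of members of ℬ) · C(#E − u, p − u)`;
* `choose_mul_card_le_choose_mul_card_shadow` — the same as `C(n,u)·#ℬ ≤ C(n,p)·#(shadow)`, `n = #E`;
* **`hall_down_of_ncard_eq`** — `|E| = p + q`, `𝒜 ⊆ U(p,q)` ⇒
  `Φ(p,q)·#𝒜 ≤ #{S ⊆ E : q < r(S) < p ∧ ∃ Z ∈ 𝒜, S ⊆ E ∖ Z}`.
Axioms: standard.
-/

namespace PercRepro

open Set Matroid Finset

/-- **The Boolean LYM shadow bound**, cancelled denominators: for a family `ℬ` of `p`-subsets of a finset `E` and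
`u ≤ p`, the family `𝒮` of `u`-subsets of members of `ℬ` satisfies `#ℬ · C(p,u) ≤ #𝒮 · C(#E − u, p − u)`
(every member has `C(p,u)` `u`-subsets, every `u`-subset of `E` has at most `C(#E − u, p − u)` `p`-supersets in `E`). -/
lemma card_mul_choose_le_card_shadow_mul {α : Type} [DecidableEq α] (E : Finset α) (ℬ : Finset (Finset α))
    (p u : ℕ) (hℬ : ∀ B ∈ ℬ, B ⊆ E ∧ B.card = p) :
    ℬ.card * p.choose u ≤ (ℬ.biUnion (fun B => B.powersetCard u)).card * (E.card - u).choose (p - u) := by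
  classical
  refine Finset.card_mul_le_card_mul (fun (B S : Finset α) => S ⊆ B) ?_ ?_
  · intro B hB
    obtain ⟨hBE, hBcard⟩ := hℬ B hB
    calc p.choose u = (B.powersetCard u).card := by rw [Finset.card_powersetCard, hBcard]
      _ ≤ ((ℬ.biUnion (fun B => B.powersetCard u)).bipartiteAbove (fun (B S : Finset α) => S ⊆ B) B).card := by
          apply Finset.card_le_card
          intro S hS
          rw [Finset.mem_bipartiteAbove]
          refine ⟨Finset.mem_biUnion.2 ⟨B, hB, hS⟩, ?_⟩
          exact (Finset.mem_powersetCard.1 hS).1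
  · intro S hS
    rw [Finset.mem_biUnion] at hS
    obtain ⟨B₀, hB₀, hS⟩ := hS
    obtain ⟨hB₀E, hB₀card⟩ := hℬ B₀ hB₀
    rw [Finset.mem_powersetCard] at hS
    obtain ⟨hSB₀, hScard⟩ := hS
    have hSE : S ⊆ E := hSB₀.trans hB₀E
    calc (ℬ.bipartiteBelow (fun (B S : Finset α) => S ⊆ B) S).card
        ≤ ((ℬ.bipartiteBelow (fun (B S : Finset α) => S ⊆ B) S).image (fun B => B \ S)).card := by
          apply le_of_eq
          symm
          apply Finset.card_image_of_injOn
          intro B₁ hB₁ B₂ hB₂ hEq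
          rw [Finset.mem_coe, Finset.mem_bipartiteBelow] at hB₁ hB₂
          have h₁ : S ⊆ B₁ := hB₁.2
          have h₂ : S ⊆ B₂ := hB₂.2
          have e₁ : B₁ = (B₁ \ S) ∪ S := by rw [Finset.sdiff_union_of_subset h₁]
          have e₂ : B₂ = (B₂ \ S) ∪ S := by rw [Finset.sdiff_union_of_subset h₂]
          rw [e₁, e₂]
          simp only at hEq
          rw [hEq]
      _ ≤ ((E \ S).powersetCard (p - u)).card := by
          apply Finset.card_le_card
          intro T hT
          rw [Finset.mem_image] at hT
          obtain ⟨B, hB, rfl⟩ := hT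
          rw [Finset.mem_bipartiteBelow] at hB
          obtain ⟨hBℬ, hSB⟩ := hB
          obtain ⟨hBE, hBcard⟩ := hℬ B hBℬ
          rw [Finset.mem_powersetCard]
          refine ⟨Finset.sdiff_subset_sdiff hBE le_rfl, ?_⟩
          rw [Finset.card_sdiff_of_subset hSB, hBcard, hScard]
      _ = (E.card - u).choose (p - u) := by
          rw [Finset.card_powersetCard, Finset.card_sdiff_of_subset hSE, hScard]

/-- The shadow bound in its binomial form: `C(n,u)·#ℬ ≤ C(n,p)·#𝒮` for `u ≤ p`, `n = #E` (`Nat.choose_mul`: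
`C(n,p)·C(p,u) = C(n,u)·C(n−u,p−u)`; cancel `C(p,u) > 0`). -/
lemma choose_mul_card_le_choose_mul_card_shadow {α : Type} [DecidableEq α] (E : Finset α) (ℬ : Finset (Finset α))
    (p u : ℕ) (hup : u ≤ p) (hℬ : ∀ B ∈ ℬ, B ⊆ E ∧ B.card = p) :
    E.card.choose u * ℬ.card ≤ E.card.choose p * (ℬ.biUnion (fun B => B.powersetCard u)).card := by
  have h := card_mul_choose_le_card_shadow_mul E ℬ p u hℬ
  have hcm : E.card.choose p * p.choose u = E.card.choose u * (E.card - u).choose (p - u) :=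
    Nat.choose_mul hup
  have hpos : 0 < p.choose u := Nat.choose_pos hup
  refine Nat.le_of_mul_le_mul_right ?_ hpos
  calc E.card.choose u * ℬ.card * p.choose u
      = E.card.choose u * (ℬ.card * p.choose u) := by ring
    _ ≤ E.card.choose u * ((ℬ.biUnion (fun B => B.powersetCard u)).card * (E.card - u).choose (p - u)) :=
        Nat.mul_le_mul_left _ h
    _ = (E.card.choose u * (E.card - u).choose (p - u)) * (ℬ.biUnion (fun B => B.powersetCard u)).card := by
        ring
    _ = (E.card.choose p * p.choose u) * (ℬ.biUnion (fun B => B.powersetCard u)).card := by rw [hcm]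
    _ = E.card.choose p * (ℬ.biUnion (fun B => B.powersetCard u)).card * p.choose u := by ring

variable {α : Type} (M : Matroid α) [M.Finite]

/-- At `|E| = p + q` the complement of a member of `U(p,q)` is a basis: an independent `p`-set. -/
lemma compl_indep_of_mem_U {p q : ℕ} (hE : M.E.ncard = p + q) {Z : Set α}
    (hZ : Z ⊆ M.E ∧ M.eRk Z = (q : ℕ∞) ∧ M.eRk (M.E \ Z) = (p : ℕ∞)) :
    M.Indep (M.E \ Z) ∧ (M.E \ Z).ncard = p := by
  obtain ⟨hZE, hqZ, hpA⟩ := hZ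
  have hEfin : M.E.Finite := M.set_finite M.E
  have hAfin : (M.E \ Z).Finite := hEfin.subset sdiff_subset
  have hZfin : Z.Finite := hEfin.subset hZE
  have hcA : p ≤ (M.E \ Z).ncard := by
    have h := hpA ▸ M.eRk_le_encard (M.E \ Z)
    rw [← hAfin.cast_ncard_eq] at h
    exact_mod_cast h
  have hcZ : q ≤ Z.ncard := by
    have h := hqZ ▸ M.eRk_le_encard Z
    rw [← hZfin.cast_ncard_eq] at h
    exact_mod_cast h
  have hsum := ncard_sdiff_add_ncard_of_subset hZE hEfin
  have hAcard : (M.E \ Z).ncard = p := by omega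
  refine ⟨?_, hAcard⟩
  rw [indep_iff_eRk_eq_encard_of_finite hAfin, hpA, ← hAfin.cast_ncard_eq, hAcard]

/-- **C-025 AT THE TIGHT LAYER FOR SUBFAMILIES — the DOWN-Hall condition**: if `|E| = p + q` then for every family
`𝒜` of members of `U(p,q)` (sets `Z ⊆ E` with `r(Z) = q`, `r(E ∖ Z) = p`),
`Φ(p,q)·#𝒜 ≤ #{S ⊆ E : q < r(S) < p, S ⊆ E ∖ Z for some Z ∈ 𝒜}` — the members of `𝒜` have at least `Φ(p,q)·#𝒜`
neighbours in `Y(p,q)` under the adjacency `S ⊆ E ∖ Z`, so a fractional `Φ`-matching from `𝒜` into `Y` exists (Hall).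
Theorem M (`c025_of_ncard_eq`) is the case `𝒜 = U(p,q)`. -/
theorem hall_down_of_ncard_eq (p q : ℕ) (hE : M.E.ncard = p + q) (𝒜 : Set (Set α))
    (h𝒜 : ∀ Z ∈ 𝒜, Z ⊆ M.E ∧ M.eRk Z = (q : ℕ∞) ∧ M.eRk (M.E \ Z) = (p : ℕ∞)) :
    phiK p q * (𝒜.ncard : ℚ) ≤
      ({S : Set α | S ⊆ M.E ∧ (q : ℕ∞) < M.eRk S ∧ M.eRk S < (p : ℕ∞) ∧ ∃ Z ∈ 𝒜, S ⊆ M.E \ Z}.ncard : ℚ) := by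
  classical
  have hEfin : M.E.Finite := M.set_finite M.E
  set Ef : Finset α := hEfin.toFinset with hEf
  have hEcard : Ef.card = M.E.ncard := (ncard_eq_toFinset_card _ hEfin).symm
  have h𝒜fin : 𝒜.Finite := hEfin.finite_subsets.subset (fun Z hZ => (h𝒜 Z hZ).1)
  -- the complement `E ∖ Z` as a finset: `Ef.filter (· ∉ Z)`
  have hcoe : ∀ Z : Set α, ((Ef.filter (fun x => x ∉ Z) : Finset α) : Set α) = M.E \ Z := by
    intro Z
    ext x
    simp [Finset.coe_filter, hEf, hEfin.mem_toFinset]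
  set ℬ : Finset (Finset α) := h𝒜fin.toFinset.image (fun Z => Ef.filter (fun x => x ∉ Z)) with hℬdef
  -- #ℬ = #𝒜 : Z ↦ E ∖ Z is injective on subsets of E
  have hℬcard : ℬ.card = 𝒜.ncard := by
    rw [hℬdef, Finset.card_image_of_injOn, ncard_eq_toFinset_card _ h𝒜fin]
    intro Z₁ hZ₁ Z₂ hZ₂ hEq
    rw [Finset.mem_coe, h𝒜fin.mem_toFinset] at hZ₁ hZ₂
    have hc : ((Ef.filter (fun x => x ∉ Z₁) : Finset α) : Set α) = ((Ef.filter (fun x => x ∉ Z₂) : Finset α) : Set α) := by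
      simp only at hEq
      rw [hEq]
    rw [hcoe, hcoe] at hc
    have h1 := (h𝒜 Z₁ hZ₁).1
    have h2 := (h𝒜 Z₂ hZ₂).1
    calc Z₁ = M.E \ (M.E \ Z₁) := (Set.sdiff_sdiff_cancel_left h1).symm
      _ = M.E \ (M.E \ Z₂) := by rw [hc]
      _ = Z₂ := Set.sdiff_sdiff_cancel_left h2
  -- every member of ℬ is a p-subset of Ef
  have hℬ : ∀ B ∈ ℬ, B ⊆ Ef ∧ B.card = p := by
    intro B hB
    rw [hℬdef, Finset.mem_image] at hB
    obtain ⟨Z, hZ, rfl⟩ := hB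
    rw [h𝒜fin.mem_toFinset] at hZ
    obtain ⟨-, hAcard⟩ := compl_indep_of_mem_U M hE (h𝒜 Z hZ)
    refine ⟨?_, ?_⟩
    · exact Finset.filter_subset _ _
    · rw [← ncard_coe_finset, hcoe, hAcard]
  -- the level-u shadows and their union F
  set F : Finset (Finset α) :=
    (Finset.Ioo q p).biUnion (fun u => ℬ.biUnion (fun B => B.powersetCard u)) with hF
  have hFcard : F.card = ∑ u ∈ Finset.Ioo q p, (ℬ.biUnion (fun B => B.powersetCard u)).card := by
    rw [hF, Finset.card_biUnion]
    intro u _ v _ huv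
    change Disjoint _ _
    rw [Finset.disjoint_left]
    intro s hs hs'
    rw [Finset.mem_biUnion] at hs hs'
    obtain ⟨B, -, hs⟩ := hs
    obtain ⟨B', -, hs'⟩ := hs'
    rw [Finset.mem_powersetCard] at hs hs'
    exact huv (hs.2.symm.trans hs'.2)
  -- the target family is finite and receives F injectively
  set T : Set (Set α) :=
    {S : Set α | S ⊆ M.E ∧ (q : ℕ∞) < M.eRk S ∧ M.eRk S < (p : ℕ∞) ∧ ∃ Z ∈ 𝒜, S ⊆ M.E \ Z} with hT
  have hTfin : T.Finite := hEfin.finite_subsets.subset (fun S hS => hS.1)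
  have hFT : ((F : Set (Finset α))).ncard ≤ T.ncard := by
    refine ncard_le_ncard_of_injOn (fun s => (s : Set α)) ?_ ?_ hTfin
    · intro s hs
      rw [Finset.mem_coe, hF, Finset.mem_biUnion] at hs
      obtain ⟨u, hu, hs⟩ := hs
      rw [Finset.mem_biUnion] at hs
      obtain ⟨B, hB, hs⟩ := hs
      rw [Finset.mem_powersetCard] at hs
      obtain ⟨hsB, hscard⟩ := hs
      rw [Finset.mem_Ioo] at hu
      -- B = E ∖ Z for a member Z, independent of size p
      have hB' := hB
      rw [hℬdef, Finset.mem_image] at hB'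
      obtain ⟨Z, hZ, rfl⟩ := hB'
      rw [h𝒜fin.mem_toFinset] at hZ
      obtain ⟨hind, -⟩ := compl_indep_of_mem_U M hE (h𝒜 Z hZ)
      have hsub : (s : Set α) ⊆ M.E \ Z := by
        rw [← hcoe Z]
        exact_mod_cast hsB
      have hsind : M.Indep (s : Set α) := hind.subset hsub
      have hrk : M.eRk (s : Set α) = (u : ℕ∞) := by
        rw [hsind.eRk_eq_encard, encard_coe_eq_coe_finsetCard, hscard]
      refine ⟨hsub.trans sdiff_subset, ?_, ?_, Z, hZ, hsub⟩
      · rw [hrk]; exact_mod_cast hu.1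
      · rw [hrk]; exact_mod_cast hu.2
    · intro s _ s' _ hEq
      exact Finset.coe_injective hEq
  rw [ncard_coe_finset, hFcard] at hFT
  -- the binomial bound at every level, summed
  have hbin : (∑ u ∈ Finset.Ioo q p, (p + q).choose u) * ℬ.card ≤
      (p + q).choose p * ∑ u ∈ Finset.Ioo q p, (ℬ.biUnion (fun B => B.powersetCard u)).card := by
    rw [Finset.sum_mul, Finset.mul_sum]
    refine Finset.sum_le_sum (fun u hu => ?_)
    rw [Finset.mem_Ioo] at hu
    have := choose_mul_card_le_choose_mul_card_shadow Ef ℬ p u (by omega) hℬ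
    rw [hEcard, hE] at this
    exact this
  have hchoose : (0 : ℚ) < ((p + q).choose p : ℚ) := by
    exact_mod_cast Nat.choose_pos (by omega)
  have hmain : phiK p q * (ℬ.card : ℚ) ≤
      ((∑ u ∈ Finset.Ioo q p, (ℬ.biUnion (fun B => B.powersetCard u)).card : ℕ) : ℚ) := by
    unfold phiK
    rw [div_mul_eq_mul_div, div_le_iff₀ hchoose]
    have h' : ((∑ u ∈ Finset.Ioo q p, (p + q).choose u : ℕ) : ℚ) * (ℬ.card : ℚ) ≤
        ((p + q).choose p : ℚ) * ((∑ u ∈ Finset.Ioo q p, (ℬ.biUnion (fun B => B.powersetCard u)).card : ℕ) : ℚ) := by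
      exact_mod_cast hbin
    push_cast at h' ⊢
    linarith
  rw [← hℬcard]
  calc phiK p q * (ℬ.card : ℚ)
      ≤ ((∑ u ∈ Finset.Ioo q p, (ℬ.biUnion (fun B => B.powersetCard u)).card : ℕ) : ℚ) := hmain
    _ ≤ (T.ncard : ℚ) := by exact_mod_cast hFT

end PercRepro
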